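import Literature.Computability.QuantumComplexity.QuantumAdvantageWave0
import HarnessLib

/-!
# Standard complex Gaussian vectors: characteristic function and unitary invariance

The law `γ^ι = ⊗_{i ∈ ι} 𝒩_ℂ(0,1)` of a vector of i.i.d. standard complex Gaussians
(`stdComplexGaussian`: real and imaginary parts independent `𝒩(0, 1/2)`), on `ι → ℂ`
(`gaussianPi ι`, the form of the Gaussian matrix ensemble `gaussianMatrixMeasure` of the tree) and
transported to `EuclideanSpace ℂ ι` (`gaussianEuc ι`), together with the facts random-matrix
arguments use about it:

* `charFun_stdComplexGaussian`, `charFun_gaussianEuc`: the characteristic function is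
  `t ↦ exp(−‖t‖²/4)` (for the real inner product `Re ⟪·,·⟫`);
* `gaussianEuc_map_linearIsometryEquiv`: **unitary invariance** — every complex-linear isometry
  `EuclideanSpace ℂ ι ≃ₗᵢ[ℂ] EuclideanSpace ℂ κ` pushes `γ^ι` to `γ^κ` (in particular unitary
  matrices, `gaussianEuc_map_unitary`, and coordinate permutations);
* `gaussianPi_map_restrict`: marginals on a sub-family of coordinates (along an injective
  re-indexing) are again standard Gaussian vectors;
* `gaussianEuc_map_orthonormal_repr`: for an orthonormal family `b : κ → EuclideanSpace ℂ ι` the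
  coefficient map `z ↦ (⟪b k, z⟫)ₖ` (a co-isometry) pushes `γ^ι` to `γ^κ`.

## References

Standard; e.g. T. Tao, *Topics in random matrix theory*, AMS 2012, §2.2 (unitary invariance of
Gaussian ensembles), and F. Mezzadri, *How to generate random matrices from the classical compact
groups*, Notices AMS 54 (2007) 592–604, §3 (the Ginibre ensemble).
-/

open MeasureTheory ProbabilityTheory Complex WithLp
open scoped ENNReal NNReal

namespace Literature.Probability.RandomMatrix

open Literature.Computability.QuantumComplexity (stdComplexGaussian)

section Defs

variable (ι : Type*) [Fintype ι]

/-- `γ^ι`: the law of a vector of i.i.d. standard complex Gaussians indexed by `ι`, as a product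
measure on `ι → ℂ`. [folklore] -/
noncomputable def gaussianPi : Measure (ι → ℂ) := Measure.pi fun _ : ι => stdComplexGaussian

/-- `γ^ι` transported to the Euclidean space `EuclideanSpace ℂ ι` (so that inner products,
orthonormal bases and isometries are available). [folklore] -/
noncomputable def gaussianEuc : Measure (EuclideanSpace ℂ ι) := (gaussianPi ι).map (toLp 2)

/-- `γ^ι` is a probability measure. [folklore] -/
instance gaussianPi.instIsProbabilityMeasure : IsProbabilityMeasure (gaussianPi ι) := by
  unfold gaussianPi; infer_instance

omit [Fintype ι] in
/-- `toLp 2` is measurable (it is the measurable equivalence `MeasurableEquiv.toLp`). [folklore] -/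
theorem measurable_toLp_two : Measurable (toLp 2 : (ι → ℂ) → EuclideanSpace ℂ ι) :=
  (MeasurableEquiv.toLp 2 (ι → ℂ)).measurable

omit [Fintype ι] in
/-- `ofLp` is measurable. [folklore] -/
theorem measurable_ofLp_two : Measurable (ofLp : EuclideanSpace ℂ ι → ι → ℂ) :=
  (MeasurableEquiv.toLp 2 (ι → ℂ)).symm.measurable

/-- `γ^ι` on the Euclidean space is a probability measure. [folklore] -/
instance gaussianEuc.instIsProbabilityMeasure : IsProbabilityMeasure (gaussianEuc ι) := by
  unfold gaussianEuc
  exact Measure.isProbabilityMeasure_map (measurable_toLp_two ι).aemeasurable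

/-- Back from the Euclidean space: `γ^ι = (γ^ι on EuclideanSpace).map ofLp`. [folklore] -/
theorem gaussianPi_eq_map_ofLp : gaussianPi ι = (gaussianEuc ι).map ofLp := by
  rw [gaussianEuc, Measure.map_map (measurable_ofLp_two ι) (measurable_toLp_two ι)]
  have : (ofLp : EuclideanSpace ℂ ι → ι → ℂ) ∘ (toLp 2) = id := funext fun x => rfl
  rw [this, Measure.map_id]

end Defs

/-! ### Characteristic functions -/

/-- The characteristic function of the standard complex Gaussian, for the real inner product
`⟪z, w⟫_ℝ = Re(z̄w)` on `ℂ`: `𝔼 e^{i⟪z,w⟫} = e^{−|w|²/4}` (each of `Re z`, `Im z` is `𝒩(0,1/2)`,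
with characteristic function `s ↦ e^{−s²/4}`). [folklore] -/
theorem charFun_stdComplexGaussian (w : ℂ) :
    charFun stdComplexGaussian w = cexp (-(‖w‖ ^ 2 / 4 : ℝ)) := by
  rw [charFun_apply, stdComplexGaussian, integral_map_equiv]
  have hinner : ∀ p : ℝ × ℝ,
      (inner ℝ (Complex.measurableEquivRealProd.symm p) w : ℝ) = p.1 * w.re + p.2 * w.im := by
    intro p
    rw [Complex.inner, Complex.measurableEquivRealProd_symm_apply]
    simp [Complex.mul_re, Complex.conj_re, Complex.conj_im]
    ring
  simp_rw [hinner]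
  have hsplit : ∀ p : ℝ × ℝ, cexp (((p.1 * w.re + p.2 * w.im : ℝ) : ℂ) * I) =
      cexp ((w.re : ℂ) * p.1 * I) * cexp ((w.im : ℂ) * p.2 * I) := by
    intro p
    rw [← Complex.exp_add]
    congr 1
    push_cast
    ring
  simp_rw [hsplit]
  rw [integral_prod_mul (μ := gaussianReal 0 (1 / 2 : ℝ≥0)) (ν := gaussianReal 0 (1 / 2 : ℝ≥0))
    (fun x : ℝ => cexp ((w.re : ℂ) * x * I)) (fun y : ℝ => cexp ((w.im : ℂ) * y * I))]
  rw [← charFun_apply_real, ← charFun_apply_real, charFun_gaussianReal, charFun_gaussianReal,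
    ← Complex.exp_add]
  congr 1
  rw [Complex.sq_norm, Complex.normSq_apply]
  push_cast
  ring

/-- The characteristic function of `γ^ι` on `EuclideanSpace ℂ ι` (real inner product
`Re ⟪·,·⟫`): `t ↦ e^{−‖t‖²/4}`. [folklore] -/
theorem charFun_gaussianEuc {ι : Type*} [Fintype ι] (t : EuclideanSpace ℂ ι) :
    charFun (gaussianEuc ι) t = cexp (-(‖t‖ ^ 2 / 4 : ℝ)) := by
  rw [gaussianEuc, gaussianPi, charFun_pi]
  simp_rw [charFun_stdComplexGaussian, ← Complex.exp_sum]
  congr 1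
  rw [EuclideanSpace.norm_sq_eq, Finset.sum_div]
  push_cast
  rw [Finset.sum_neg_distrib]

/-! ### Unitary invariance -/

/-- The real inner product of `EuclideanSpace ℂ ι` (as a product of copies of the real inner
product space `ℂ`) is the real part of the complex one. [folklore] -/
theorem real_inner_euclideanSpace_eq_re {ι : Type*} [Fintype ι] (x y : EuclideanSpace ℂ ι) :
    (inner ℝ x y : ℝ) = (inner ℂ x y).re := by
  rw [PiLp.inner_apply, PiLp.inner_apply, Complex.re_sum]
  refine Finset.sum_congr rfl fun i _ => ?_
  rw [real_inner_eq_re_inner ℂ]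
  rfl

/-- **Unitary invariance of the complex Gaussian vector.** Every complex-linear isometric
isomorphism `U : ℂ^ι ≃ ℂ^κ` pushes `γ^ι` forward to `γ^κ` (the characteristic function
`e^{−‖t‖²/4}` is invariant). [folklore] -/
theorem gaussianEuc_map_linearIsometryEquiv {ι κ : Type*} [Fintype ι] [Fintype κ]
    (U : EuclideanSpace ℂ ι ≃ₗᵢ[ℂ] EuclideanSpace ℂ κ) :
    (gaussianEuc ι).map U = gaussianEuc κ := by
  apply Measure.ext_of_charFun
  funext t
  rw [charFun_apply, integral_map U.continuous.measurable.aemeasurable (by fun_prop),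
    charFun_gaussianEuc]
  have h : ∀ x : EuclideanSpace ℂ ι, (inner ℝ (U x) t : ℝ) = inner ℝ x (U.symm t) := by
    intro x
    rw [real_inner_euclideanSpace_eq_re, real_inner_euclideanSpace_eq_re,
      LinearIsometryEquiv.inner_map_eq_flip]
  simp_rw [h]
  rw [← charFun_apply, charFun_gaussianEuc, LinearIsometryEquiv.norm_map]

/-- Coordinate permutations preserve `γ^ι` (on the Euclidean space). [folklore] -/
theorem gaussianEuc_map_piLpCongrLeft {ι κ : Type*} [Fintype ι] [Fintype κ] (e : ι ≃ κ) :
    (gaussianEuc ι).map (LinearIsometryEquiv.piLpCongrLeft 2 ℂ ℂ e) = gaussianEuc κ :=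
  gaussianEuc_map_linearIsometryEquiv _

section Unitary

variable {ι : Type*} [Fintype ι] [DecidableEq ι]

/-- A unitary matrix preserves the inner product of `EuclideanSpace ℂ ι`:
`⟪Ux, Uy⟫ = ⟪x, y⟫`. [folklore] -/
theorem inner_unitary_mulVec (U : Matrix.unitaryGroup ι ℂ) (x y : ι → ℂ) :
    inner ℂ (toLp 2 ((U : Matrix ι ι ℂ).mulVec x)) (toLp 2 ((U : Matrix ι ι ℂ).mulVec y)) =
      inner ℂ (toLp 2 x : EuclideanSpace ℂ ι) (toLp 2 y) := by
  rw [EuclideanSpace.inner_eq_star_dotProduct, EuclideanSpace.inner_eq_star_dotProduct]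
  change (U : Matrix ι ι ℂ).mulVec y ⬝ᵥ star ((U : Matrix ι ι ℂ).mulVec x) = y ⬝ᵥ star x
  rw [Matrix.star_mulVec, dotProduct_comm, Matrix.dotProduct_mulVec, Matrix.vecMul_vecMul,
    ← Matrix.star_eq_conjTranspose, Matrix.mem_unitaryGroup_iff'.1 U.2, Matrix.vecMul_one,
    dotProduct_comm]

/-- The unitary matrix `U` as a complex-linear isometric isomorphism `x ↦ Ux` of
`EuclideanSpace ℂ ι`. [folklore] -/
noncomputable def unitaryEuclidean (U : Matrix.unitaryGroup ι ℂ) :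
    EuclideanSpace ℂ ι ≃ₗᵢ[ℂ] EuclideanSpace ℂ ι :=
  LinearEquiv.isometryOfInner
    ((WithLp.linearEquiv 2 ℂ (ι → ℂ)).trans
      ((Matrix.UnitaryGroup.toLinearEquiv U).trans (WithLp.linearEquiv 2 ℂ (ι → ℂ)).symm))
    (fun x y => by
      change inner ℂ (toLp 2 (Matrix.toLin' (U : Matrix ι ι ℂ) (ofLp x)))
          (toLp 2 (Matrix.toLin' (U : Matrix ι ι ℂ) (ofLp y))) = inner ℂ x y
      simp only [Matrix.toLin'_apply]
      exact inner_unitary_mulVec U (ofLp x) (ofLp y))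

/-- `unitaryEuclidean U` acts as `x ↦ U x`. [folklore] -/
@[simp] theorem unitaryEuclidean_apply (U : Matrix.unitaryGroup ι ℂ) (x : EuclideanSpace ℂ ι) :
    unitaryEuclidean U x = toLp 2 ((U : Matrix ι ι ℂ).mulVec (ofLp x)) := rfl

/-- **Unitary invariance, matrix form (Euclidean space).** [folklore] -/
theorem gaussianEuc_map_unitary (U : Matrix.unitaryGroup ι ℂ) :
    (gaussianEuc ι).map (fun x => toLp 2 ((U : Matrix ι ι ℂ).mulVec (ofLp x))) = gaussianEuc ι :=
  gaussianEuc_map_linearIsometryEquiv (unitaryEuclidean U)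

/-- **Unitary invariance, matrix form (functions).** The law `γ^ι` on `ι → ℂ` is invariant
under `x ↦ Ux` for every unitary matrix `U`. [folklore] -/
theorem gaussianPi_map_unitary_mulVec (U : Matrix.unitaryGroup ι ℂ) :
    (gaussianPi ι).map (fun x => (U : Matrix ι ι ℂ).mulVec x) = gaussianPi ι := by
  have hU : Measurable fun x : ι → ℂ => (U : Matrix ι ι ℂ).mulVec x :=
    (Matrix.UnitaryGroup.toLinearEquiv U).toLinearMap.continuous_of_finiteDimensional.measurable
  have h1 := gaussianEuc_map_unitary U
  have h2 : (fun x : EuclideanSpace ℂ ι => toLp 2 ((U : Matrix ι ι ℂ).mulVec (ofLp x))) =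
      (toLp 2) ∘ (fun x : ι → ℂ => (U : Matrix ι ι ℂ).mulVec x) ∘ ofLp := rfl
  rw [gaussianPi_eq_map_ofLp ι]
  rw [Measure.map_map hU (measurable_ofLp_two ι)]
  conv_rhs => rw [← h1]
  rw [h2, Measure.map_map (measurable_ofLp_two ι) ((measurable_toLp_two ι).comp (hU.comp
    (measurable_ofLp_two ι))), ← Function.comp_assoc, ← Function.comp_assoc]
  have : (ofLp : EuclideanSpace ℂ ι → ι → ℂ) ∘ (toLp 2) = id := funext fun x => rfl
  rw [this, Function.id_comp]

end Unitary

/-! ### Marginals and co-isometries -/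

/-- **Marginals of a product of probability measures along an injective re-indexing.**
For `φ : κ → ι` injective, `(⊗_{i} μ i) ∘ (x ↦ x ∘ φ)⁻¹ = ⊗_{k} μ (φ k)`. [folklore] -/
theorem pi_map_comp_injective {ι κ : Type*} [Fintype ι] [Fintype κ] {X : Type*}
    [MeasurableSpace X] (μ : ι → Measure X) [∀ i, IsProbabilityMeasure (μ i)] {φ : κ → ι}
    (hφ : Function.Injective φ) :
    (Measure.pi μ).map (fun x k => x (φ k)) = Measure.pi fun k => μ (φ k) := by
  classical
  have hmeas : Measurable fun (x : ι → X) (k : κ) => x (φ k) :=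
    measurable_pi_lambda _ fun k => measurable_pi_apply (φ k)
  refine (Measure.pi_eq fun s hs => ?_).symm
  rw [Measure.map_apply hmeas (MeasurableSet.univ_pi hs)]
  have hpre : (fun (x : ι → X) (k : κ) => x (φ k)) ⁻¹' Set.univ.pi s =
      Set.univ.pi (Function.extend φ s fun _ => Set.univ) := by
    ext x
    simp only [Set.mem_preimage, Set.mem_univ_pi]
    constructor
    · intro h i
      by_cases hi : ∃ k, φ k = i
      · obtain ⟨k, rfl⟩ := hi
        rw [hφ.extend_apply]; exact h k
      · rw [Function.extend_apply' _ _ _ hi]; exact Set.mem_univ _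
    · intro h k
      have := h (φ k)
      rwa [hφ.extend_apply] at this
  rw [hpre, Measure.pi_pi]
  have hsplit : ∏ i, μ i (Function.extend φ s (fun _ => Set.univ) i) =
      ∏ i ∈ Finset.univ.image φ, μ i (Function.extend φ s (fun _ => Set.univ) i) := by
    refine (Finset.prod_subset (Finset.subset_univ _) fun i _ hi => ?_).symm
    have hi' : ¬ ∃ k, φ k = i := by
      rintro ⟨k, rfl⟩; exact hi (Finset.mem_image_of_mem φ (Finset.mem_univ k))
    rw [Function.extend_apply' _ _ _ hi', measure_univ]
  rw [hsplit, Finset.prod_image fun k _ k' _ h => hφ h]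
  refine Finset.prod_congr rfl fun k _ => ?_
  rw [hφ.extend_apply]

/-- **Marginals of `γ^ι`.** Restricting a standard complex Gaussian vector to a sub-family of
coordinates (along an injective `φ : κ → ι`) gives a standard complex Gaussian vector. [folklore] -/
theorem gaussianPi_map_restrict {ι κ : Type*} [Fintype ι] [Fintype κ] {φ : κ → ι}
    (hφ : Function.Injective φ) :
    (gaussianPi ι).map (fun x k => x (φ k)) = gaussianPi κ := by
  unfold gaussianPi
  exact pi_map_comp_injective _ hφ

/-- **Co-isometries push `γ^ι` to `γ^κ`.** For an orthonormal family `b : κ → ℂ^ι` the coefficient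
map `z ↦ (⟪b k, z⟫)_{k ∈ κ}` sends `γ^ι` to `γ^κ` (complete `b` to an orthonormal basis, use unitary
invariance, and take the marginal). [folklore] -/
theorem gaussianEuc_map_orthonormal_repr {ι κ : Type*} [Fintype ι] [Fintype κ]
    {b : κ → EuclideanSpace ℂ ι} (hb : Orthonormal ℂ b) :
    (gaussianEuc ι).map (fun z => fun k => inner ℂ (b k) z) = gaussianPi κ := by
  classical
  have hinj : Function.Injective b := hb.linearIndependent.injective
  have hb' : Orthonormal ℂ (Subtype.val : Set.range b → EuclideanSpace ℂ ι) :=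
    (orthonormal_subtype_range hinj).2 hb
  obtain ⟨u, B, huv, hB⟩ := hb'.exists_orthonormalBasis_extension
  let φ : κ → u := fun k => ⟨b k, huv (Set.mem_range_self k)⟩
  have hφ : Function.Injective φ := fun k k' h => hinj (congrArg Subtype.val h)
  have hF : (fun z : EuclideanSpace ℂ ι => fun k => inner ℂ (b k) z) =
      (fun c : (u → ℂ) => fun k => c (φ k)) ∘ ((ofLp : EuclideanSpace ℂ u → u → ℂ) ∘ B.repr) := by
    funext z; funext k
    simp only [Function.comp_apply]
    rw [OrthonormalBasis.repr_apply_apply, hB]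
  have hres : Measurable fun (c : u → ℂ) (k : κ) => c (φ k) :=
    measurable_pi_lambda _ fun k => measurable_pi_apply (φ k)
  have hrepr : Measurable (B.repr : EuclideanSpace ℂ ι → EuclideanSpace ℂ u) :=
    B.repr.continuous.measurable
  rw [hF, ← Measure.map_map hres ((measurable_ofLp_two u).comp hrepr),
    ← Measure.map_map (measurable_ofLp_two u) hrepr, gaussianEuc_map_linearIsometryEquiv B.repr,
    ← gaussianPi_eq_map_ofLp, gaussianPi_map_restrict hφ]

end Literature.Probability.RandomMatrix
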